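import Literature.MathematicalPhysics.QuantumFieldTheory.Balaban1983to89.B12Spaces329Near
import Literature.MathematicalPhysics.QuantumFieldTheory.Balaban1983to89.B12Spaces329BCH

/-!
# `Balaban1983to89.B12Spaces329NearSharp` — T. Bałaban, *Renormalization group approach to lattice gauge field theories. I*,
Commun. Math. Phys. **109** (1987) 249–301 [Balaban1987RG1]: the clause of (3.29) p. 276 «for Gᶜ-valued transformations u in a
sufficiently small neighborhood of G-valued transformations, so that the configurations after the transformations belong to proper spaces
also» for the CONCRETE conditions (i)–(iii) of [I] §1 (`B12RegularSpaces111.SatisfiesI_III`) WITH CONSTANTS CONTINUOUS AT THE `G`-VALUED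
TRANSFORMATIONS: a pair `(𝐔, 𝐉)` satisfying (i)–(iii) with `(α₀, α₁, γ₀)` is carried by `v = w·exp(iξE)` (`w` `G`-valued, `|E| ≤ δ₀`,
`|∇^ξ_𝐔E| ≤ δ₁`) to a pair satisfying (i)–(iii) with ANY `α₀′ ≥ e^{2ξδ₀}α₀`, `γ₀′ ≥ e^{2ξδ₀}γ₀`, `α₁′ ≥ α₁ + (3 + 12α₁ + 3ξα₀)δ₀ + 4δ₁`
(PROVED; so `(α₀′, α₁′, γ₀′) → (α₀, α₁, γ₀)` as `(δ₀, δ₁) → 0`, and for all target constants `α₀′ > α₀`, `α₁′ > α₁`, `γ₀′ > γ₀` SOME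
neighbourhood `δ > 0` works: `exists_neighbourhood`)

HONEST FRAMING (cell `lit-balaban`, verbatim): statement-level skeleton of published theorems with citation tags; proofs where landed; nothing here is a claim about the Yang–Mills mass gap.

PDF held: `paper:balaban1987-cmp109-rg-i-small-field` (journal page = PDF page + 248); pp. 262–263, 275–276 read from the text layer.

WHAT IS REPRODUCED.  SKELETON row `B12.Eq3.28-3.29` (member (3.29), the «proper spaces» clause; also the last sentence of
[Balaban1988RG2Cluster] Lemma 2, row `B13.Lem2`).  The sibling `B12Spaces329Near` (p07 gen 4, p248664) proves the clause with
`α₁′ = (1 + 11ξ(α₁+2δ₀))(α₁ + 2δ₀ + 2ξα₀δ₀ + 2((1+4ξα₁)δ₁ + 4α₁δ₀))`, which tends to `(1 + 11ξα₁)α₁ ≠ α₁` as `(δ₀, δ₁) → 0` — its header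
records the defect («the tree's BCH remainder bounds are Lipschitz bounds, not sharp at E = 0») and the consequent restriction
`11ξα₁ + O(δ₀+δ₁) ≤ β/(1+β)` in the printed use (target constants `(1+2β)α₀, (1+2β)α₁` against `(1+β)α₀, (1+β)α₁`, p. 275).  This file
removes the defect with the SECOND-INCREMENT bound of the BCH remainder (`B12Spaces329BCH`: the `X`-Lipschitz constant of
`G(X, Y) = log(e^Xe^Y) − X − Y` is `O(‖Y‖)` and conversely): the two BCH compositions in the new potential
`A″(b) = newPot ξ E(b₋) (newPot ξ A′(b) (−R(U(b))E(b₊)))` now cost `O(δ₀ + δ₁)` in (ii), not `O(ξα₁)·α₁`, so that for EVERY `β > 0` a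
neighbourhood exists — the qualitative content of «sufficiently small neighborhood».  NOT reproduced (as in the sibling): the invariance of
the FUNCTIONS (3.25)/(3.26); condition (iv).

THE PRINT, verbatim (p. 276): *«The functions (3.25), (3.26) are gauge invariant with respect to the simultaneous gauge transformations
𝐔 → 𝐔^u, 𝐉 → R(u)𝐉, B → R(u)B, (3.29)  for Gᶜ-valued transformations u in a sufficiently small neighborhood of G-valued transformations, so
that the configurations after the transformations belong to proper spaces also.»*  p. 275: *«This space is defined by the same conditions
(i)–(iv), only the configurations 𝐔, 𝐉 are defined and satisfy (i)–(iii) on the whole lattice T_η.»*  p. 262: *«(ii) U′ = exp iξA′, A′ has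
values in the algebra 𝔤ᶜ, |A′|, |∇^ξ_U A′| < α₁ on X. (1.13)»*.

THE STATEMENT PROVED.  Model hypotheses and frame exactly as in `B12Spaces329Near.satisfiesI_III_act_near` (`‖·‖ ≤ 1` on `G`, `G ≤ Gᶜ`,
`𝔤ᶜ` `Ad(G)`- and `Ad(exp iξE)`-stable and closed under `newPot` near `0`; frame region = the whole lattice; `O(1)LMB ≥ 0`); the
neighbourhood `v = w·exp(iξE)`, `w` `G`-valued, `E(x) ∈ 𝔤ᶜ`, `exp iξE(x) ∈ Gᶜ`, `|E(x)| ≤ δ₀`, `|∇^ξ_{𝐔,μ}E(x)| ≤ δ₁`, regime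
`ξ(α₁ + 2δ₀) ≤ 1/16`.  CONCLUSION (`satisfiesI_III_act_near_sharp`): `SatisfiesI_III (α₀, α₁, γ₀) (𝐔, 𝐉) → SatisfiesI_III (α₀′, α₁′, γ₀′)
((𝐔, 𝐉)^v)` for any `α₀′ ≥ e^{2ξδ₀}α₀`, `γ₀′ ≥ e^{2ξδ₀}γ₀`, `α₁′ ≥ α₁ + (3 + 12α₁ + 3ξα₀)δ₀ + 4δ₁`; and (`exists_neighbourhood`) for all
`α₀′ > α₀`, `α₁′ > α₁`, `γ₀′ > γ₀` there is `δ > 0` such that `|E| ≤ δ`, `|∇^ξ_𝐔E| ≤ δ` suffice.  The budget (ours): `|A″(b)| ≤ |A′(b)| + 2δ₀ +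
4ξ(α₁+2δ₀)δ₀` (`norm_newPot3_le_sharp`, from `B12Spaces329BCH.norm_newPot_le_sharp` twice); the covariant derivative of the transported
constituent `T = −R(U(b))E(b₊)` is `≤ 2ξα₀δ₀ + δ₁ᵁ` (`B12Spaces329NearBond.norm_covD_transport_le`, `δ₁ᵁ` the derivative bound in the
`G`-valued factor), that of `N = newPot ξ A′ T` is `≤ (1+4ξδ₀)|∇A′| + (1+4ξα₁)|∇T|`, that of `A″ = newPot ξ E N` is
`≤ (1+4ξ(α₁+(9/8)δ₀))|∇E| + (1+4ξδ₀)|∇N|` (`B12Spaces329BCH.norm_covD_newPot_le_sharp`, twice), whence `|∇A″| < α₁ + (17/32)δ₀ + (179/64)δ₁ᵁ +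
(45/16)ξα₀δ₀ ≤ α₁ + 3(δ₀ + δ₁ᵁ + ξα₀δ₀)` (`budgetII_sharp`); finally `δ₁ᵁ ≤ (1+4ξα₁)δ₁ + 4α₁δ₀` (`B12Spaces329NearBond.norm_nabla_factor_le`).
The factorisation (`factors_near`), condition (iii) (`condIII_near`) and condition (i) (`B12RegularSpaces111Gauge.condI_gaugeU`) are the
sibling's, BY NAME.  No `Prop` placeholder, no definition, no new fact; axioms standard.  Unit `lit-balaban-p07` (Phase-2 seat p07 gen 5;
TAKING line HOME/STATUS.md 2026-08-21T05:21:42Z), HOME `run/shared/lean/pub/lit-balaban/`.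
-/

namespace Literature.MathematicalPhysics.QuantumFieldTheory.Balaban1983to89.B12Spaces329NearSharp

open NormedSpace
open Literature.MathematicalPhysics.QuantumFieldTheory.Balaban1983to89
open Literature.MathematicalPhysics.QuantumFieldTheory.Balaban1983to89.B12RegularSpaces111
open Literature.MathematicalPhysics.QuantumFieldTheory.Balaban1983to89.B12RegularSpaces111Gauge
open Literature.MathematicalPhysics.QuantumFieldTheory.Balaban1983to89.B12RegularSpaces111Mono
open Literature.MathematicalPhysics.QuantumFieldTheory.Balaban1983to89.B12Membership314
open Literature.MathematicalPhysics.QuantumFieldTheory.Balaban1983to89.B12Membership313II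
open Literature.MathematicalPhysics.QuantumFieldTheory.Balaban1983to89.B12Spaces329NearBond
open Literature.MathematicalPhysics.QuantumFieldTheory.Balaban1983to89.B12Spaces329Near
open Literature.MathematicalPhysics.QuantumFieldTheory.Balaban1983to89.B12Spaces329BCH
open Complex (I)

noncomputable section

variable {P : Params} {i : ℕ} {𝔸 : Type*} [NormedRing 𝔸] [NormedAlgebra ℂ 𝔸] [CompleteSpace 𝔸]
variable {𝓜 : Model 𝔸}

/-- Lattice translations commute. [folklore] -/
private theorem shift_shift_comm (x : Site P i) (μ ν : Fin P.d) : (x.shift μ).shift ν = (x.shift ν).shift μ := by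
  funext κ
  by_cases h1 : κ = ν
  · subst h1
    by_cases h2 : κ = μ
    · subst h2; rfl
    · simp [Site.shift, Function.update_apply, h2]
  · by_cases h2 : κ = μ
    · subst h2; simp [Site.shift, Function.update_apply, h1]
    · simp [Site.shift, Function.update_apply, h1, h2]

/-! ## §1. Sharp sizes of the new potential `A″(b) = newPot ξ E(b₋) (newPot ξ A′(b) (−R(U(b))E(b₊)))` -/

omit P i in
/-- **Sharp size of the inner composition `N = newPot ξ A′(b) (−R(U(b))E(b₊))`.**  If `|E(b₊)| ≤ δ`, `|A′(b)| ≤ α₁`, `U(b) ∈ G`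
(`‖·‖ ≤ 1` on `G`), `ξ > 0`, `ξ(α₁ + 2δ) ≤ 1/16`: the BCH step is in range and `|N| ≤ |A′(b)| + δ + 2ξα₁δ ≤ α₁ + (9/8)δ`
(`B12Spaces329BCH.norm_newPot_le_sharp`: the correction is bilinear, `2ξ|A′(b)||E(b₊)|`).  Compare `B12Spaces329NearBond.norm_newPot2_le`
(`+ 3ξ(α₁ + 2δ)²`). [cite: Balaban1987RG1, (3.29) p.276] -/
theorem norm_newPot2_le_sharp {G : Subgroup 𝔸ˣ} (hG1 : ∀ g ∈ G, ‖(g : 𝔸)‖ ≤ 1) {ξ α₁ δ : ℝ} (hξ : 0 < ξ) (hα₁ : 0 ≤ α₁)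
    (hδ : 0 ≤ δ) (hs : ξ * (α₁ + 2 * δ) ≤ 1 / 16) {U : 𝔸ˣ} (hU : U ∈ G) {E₁ A : 𝔸} (hE₁ : ‖E₁‖ ≤ δ) (hA : ‖A‖ ≤ α₁) :
    ξ * (‖A‖ + ‖(U : 𝔸) * (-E₁) * ↑U⁻¹‖) ≤ 1 / 16 ∧
      ‖newPot ξ A ((U : 𝔸) * (-E₁) * ↑U⁻¹)‖ ≤ ‖A‖ + δ + 2 * ξ * α₁ * δ ∧
        ‖newPot ξ A ((U : 𝔸) * (-E₁) * ↑U⁻¹)‖ ≤ α₁ + (9 / 8) * δ := by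
  set T := (U : 𝔸) * (-E₁) * ↑U⁻¹ with hT
  have hTn : ‖T‖ ≤ δ := by rw [hT, norm_conj_eq hG1 hU, norm_neg]; exact hE₁
  have h1 : ξ * (‖A‖ + ‖T‖) ≤ 1 / 16 := by nlinarith [norm_nonneg A, norm_nonneg T]
  have hN := norm_newPot_le_sharp hξ (h1.trans (by norm_num))
  have hξα : ξ * α₁ ≤ 1 / 16 := by nlinarith
  have h2 : 2 * ξ * ‖A‖ * ‖T‖ ≤ 2 * ξ * α₁ * δ := by
    have := mul_le_mul hA hTn (norm_nonneg _) hα₁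
    nlinarith [hξ.le]
  have hN' : ‖newPot ξ A T‖ ≤ ‖A‖ + δ + 2 * ξ * α₁ * δ := by linarith
  refine ⟨h1, hN', hN'.trans ?_⟩
  nlinarith

omit P i in
/-- **Sharp size of `A″(b) = newPot ξ E(b₋) N`.**  If moreover `|E(b₋)| ≤ δ`: the second BCH step is in range (`ξ(|E(b₋)| + |N|) ≤ 1/8`) and
`|A″(b)| ≤ |A′(b)| + 2δ + 4ξ(α₁ + 2δ)δ ≤ |A′(b)| + (9/4)δ` — the correction to `|A′(b)|` VANISHES with `δ`.  Compare
`B12Spaces329NearBond.norm_newPot3_le` (`+ 8ξ(α₁ + 2δ)²`). [cite: Balaban1987RG1, (3.29) p.276] -/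
theorem norm_newPot3_le_sharp {G : Subgroup 𝔸ˣ} (hG1 : ∀ g ∈ G, ‖(g : 𝔸)‖ ≤ 1) {ξ α₁ δ : ℝ} (hξ : 0 < ξ) (hα₁ : 0 ≤ α₁)
    (hδ : 0 ≤ δ) (hs : ξ * (α₁ + 2 * δ) ≤ 1 / 16) {U : 𝔸ˣ} (hU : U ∈ G) {E₀ E₁ A : 𝔸} (hE₀ : ‖E₀‖ ≤ δ) (hE₁ : ‖E₁‖ ≤ δ)
    (hA : ‖A‖ ≤ α₁) :
    ξ * (‖E₀‖ + ‖newPot ξ A ((U : 𝔸) * (-E₁) * ↑U⁻¹)‖) ≤ 1 / 8 ∧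
      ‖newPot ξ E₀ (newPot ξ A ((U : 𝔸) * (-E₁) * ↑U⁻¹))‖ ≤ ‖A‖ + 2 * δ + 4 * ξ * (α₁ + 2 * δ) * δ ∧
        ‖newPot ξ E₀ (newPot ξ A ((U : 𝔸) * (-E₁) * ↑U⁻¹))‖ ≤ ‖A‖ + (9 / 4) * δ := by
  obtain ⟨-, hN', hN9⟩ := norm_newPot2_le_sharp hG1 hξ hα₁ hδ hs hU hE₁ hA
  set N := newPot ξ A ((U : 𝔸) * (-E₁) * ↑U⁻¹) with hNdef
  have hξα : ξ * α₁ ≤ 1 / 16 := by nlinarith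
  have hξδ : ξ * δ ≤ 1 / 32 := by nlinarith
  have h2 : ξ * (‖E₀‖ + ‖N‖) ≤ 1 / 8 := by
    have h0 : ‖E₀‖ + ‖N‖ ≤ α₁ + (17 / 8) * δ := by linarith
    have : ξ * (‖E₀‖ + ‖N‖) ≤ ξ * (α₁ + (17 / 8) * δ) := mul_le_mul_of_nonneg_left h0 hξ.le
    nlinarith
  have hM := norm_newPot_le_sharp hξ (h2.trans (by norm_num))
  have h3 : 2 * ξ * ‖E₀‖ * ‖N‖ ≤ 2 * ξ * δ * (α₁ + (9 / 8) * δ) := by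
    have := mul_le_mul hE₀ hN9 (norm_nonneg _) hδ
    nlinarith [hξ.le]
  have h6 : 0 ≤ ξ * δ * δ := by positivity
  have h7 : ‖E₀‖ + ‖N‖ + 2 * ξ * ‖E₀‖ * ‖N‖ ≤ ‖A‖ + 2 * δ + 4 * ξ * (α₁ + 2 * δ) * δ := by
    nlinarith [hE₀, hN', h3, h6]
  refine ⟨h2, hM.trans h7, (hM.trans h7).trans ?_⟩
  have h4 : 4 * ξ * (α₁ + 2 * δ) * δ ≤ δ / 4 := by nlinarith
  linarith

/-! ## §2. Condition (ii), (1.13), for the new pair `(U^w, R(w)A″)` — sharp budget -/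

omit P i 𝔸 in
/-- Real arithmetic: the sharp budget of (ii).  With nonnegative letters and `ξ(α₁ + 2δ₀) ≤ 1/16`:
`(1 + 4ξ(α₁ + (9/8)δ₀))δ₁ + (1 + 4ξδ₀)((1 + 4ξδ₀)α₁ + (1 + 4ξα₁)(2ξα₀δ₀ + δ₁)) ≤ α₁ + 3(δ₀ + δ₁ + ξα₀δ₀)`
(numerically `≤ α₁ + (17/32)δ₀ + (179/64)δ₁ + (45/16)ξα₀δ₀`). [folklore] -/
private theorem budgetII_sharp {ξ α₀ α₁ δ₀ δ₁ : ℝ} (hξ : 0 ≤ ξ) (hα₀ : 0 ≤ α₀) (hα₁ : 0 ≤ α₁) (hδ₀ : 0 ≤ δ₀) (hδ₁ : 0 ≤ δ₁)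
    (hs : ξ * (α₁ + 2 * δ₀) ≤ 1 / 16) :
    (1 + 4 * (ξ * (α₁ + (9 / 8) * δ₀))) * δ₁ +
        (1 + 4 * (ξ * δ₀)) * ((1 + 4 * (ξ * δ₀)) * α₁ + (1 + 4 * (ξ * α₁)) * (2 * ξ * α₀ * δ₀ + δ₁)) ≤
      α₁ + 3 * (δ₀ + δ₁ + ξ * α₀ * δ₀) := by
  have hx : ξ * α₁ ≤ 1 / 16 := by nlinarith
  have hy : ξ * δ₀ ≤ 1 / 32 := by nlinarith
  have hx0 : 0 ≤ ξ * α₁ := mul_nonneg hξ hα₁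
  have hy0 : 0 ≤ ξ * δ₀ := mul_nonneg hξ hδ₀
  have hτ0 : 0 ≤ 2 * ξ * α₀ * δ₀ + δ₁ := by positivity
  -- (1) the `∇E` term
  have t1 : (1 + 4 * (ξ * (α₁ + (9 / 8) * δ₀))) * δ₁ ≤ (89 / 64) * δ₁ := by
    apply mul_le_mul_of_nonneg_right _ hδ₁; nlinarith
  -- (2) the `∇A′` term: `(1+4ξδ₀)²α₁ ≤ α₁ + (17/32)δ₀`
  have t2 : (1 + 4 * (ξ * δ₀)) * ((1 + 4 * (ξ * δ₀)) * α₁) ≤ α₁ + (17 / 32) * δ₀ := by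
    have e : (1 + 4 * (ξ * δ₀)) * ((1 + 4 * (ξ * δ₀)) * α₁) = α₁ + 8 * (ξ * α₁) * δ₀ + 16 * ((ξ * α₁) * (ξ * δ₀)) * δ₀ := by
      ring
    rw [e]
    have h1 : (ξ * α₁) * δ₀ ≤ (1 / 16) * δ₀ := mul_le_mul_of_nonneg_right hx hδ₀
    have h2 : ((ξ * α₁) * (ξ * δ₀)) * δ₀ ≤ ((1 / 16) * (1 / 32)) * δ₀ :=
      mul_le_mul_of_nonneg_right (mul_le_mul hx hy hy0 (by norm_num)) hδ₀
    linarith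
  -- (3) the `∇T` term: `(1+4ξδ₀)(1+4ξα₁) ≤ 45/32`
  have t3 : (1 + 4 * (ξ * δ₀)) * ((1 + 4 * (ξ * α₁)) * (2 * ξ * α₀ * δ₀ + δ₁)) ≤ (45 / 32) * (2 * ξ * α₀ * δ₀ + δ₁) := by
    rw [← mul_assoc]
    apply mul_le_mul_of_nonneg_right _ hτ0
    have h2 : (ξ * δ₀) * (ξ * α₁) ≤ (1 / 32) * (1 / 16) := mul_le_mul hy hx hx0 (by norm_num)
    nlinarith
  have e : (1 + 4 * (ξ * δ₀)) * ((1 + 4 * (ξ * δ₀)) * α₁ + (1 + 4 * (ξ * α₁)) * (2 * ξ * α₀ * δ₀ + δ₁)) =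
      (1 + 4 * (ξ * δ₀)) * ((1 + 4 * (ξ * δ₀)) * α₁) + (1 + 4 * (ξ * δ₀)) * ((1 + 4 * (ξ * α₁)) * (2 * ξ * α₀ * δ₀ + δ₁)) := by
    ring
  rw [e]
  have hξαδ : 0 ≤ ξ * α₀ * δ₀ := by positivity
  nlinarith

/-- **(ii) for the new pair `(U^w, R(w)A″)`, sharp form.**  Frame region = the whole lattice.  If `U` satisfies (i) with `α₀` and `(U, A′)`
satisfy (ii) with `α₁`, `w` is `G`-valued, `E` is `𝔤ᶜ`-valued with `|E| ≤ δ₀` and `|∇^ξ_{U,μ}E| ≤ δ₁` (covariant derivative in the `G`-valued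
factor), and `ξ(α₁ + 2δ₀) ≤ 1/16`, then `(U^w, R(w)A″)` satisfy (ii) with any `α₁′ ≥ α₁ + 3(δ₀ + δ₁ + ξα₀δ₀)` — the excess over `α₁` is
`O(δ₀ + δ₁)`.  Mechanism: `|A″(b)| ≤ |A′(b)| + (9/4)δ₀` (`norm_newPot3_le_sharp`); the covariant derivative of each BCH composition is that of
its constituents with factors `1 + O(size of the other constituent)` (`B12Spaces329BCH.norm_covD_newPot_le_sharp`, twice); the transported
constituent `−R(U(b))E(b₊)` has covariant derivative `≤ 2ξα₀δ₀ + δ₁` (`B12Spaces329NearBond.norm_covD_transport_le`); `R(w)` is an isometry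
commuting with `∇^ξ` (`nabla_gaugeU_adJ`).  Compare `B12Spaces329Near.condII_near` (`α₁′ ≥ (1 + 11ξ(α₁+2δ₀))(α₁ + 2δ₀ + 2ξα₀δ₀ + 2δ₁)`).
[cite: Balaban1987RG1, (3.29) p.276] -/
theorem condII_near_sharp (hG1 : ∀ g ∈ 𝓜.G, ‖(g : 𝔸)‖ ≤ 1) (hgc : ∀ g ∈ 𝓜.G, ∀ X ∈ 𝓜.gc, (g : 𝔸) * X * ↑g⁻¹ ∈ 𝓜.gc)
    (hgcN : ∀ (ξ : ℝ) (X : 𝔸), X ∈ 𝓜.gc → ∀ Y ∈ 𝓜.gc, ξ * (‖X‖ + ‖Y‖) ≤ 1 / 4 → newPot ξ X Y ∈ 𝓜.gc)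
    {F : Frame P i 𝔸} (hXb : ∀ b, b ∈ F.X.bonds) (hXp : ∀ p, p ∈ F.X.plaqs) {c : StepConsts} (hξ : 0 < c.ξ)
    {α₀ α₁ δ₀ δ₁ α₁' : ℝ} (hα₀ : 0 ≤ α₀) (hα₁ : 0 ≤ α₁) (hδ₀ : 0 ≤ δ₀) (hδ₁ : 0 ≤ δ₁) (hs : c.ξ * (α₁ + 2 * δ₀) ≤ 1 / 16)
    (hα₁' : α₁ + 3 * (δ₀ + δ₁ + c.ξ * α₀ * δ₀) ≤ α₁')
    {U : PBond P i → 𝔸ˣ} {A' : PBond P i → 𝔸} (hI : CondI 𝓜 F c α₀ U) (hII : CondII 𝓜 F.X c α₁ U A')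
    {w : Site P i → 𝔸ˣ} (hw : ∀ x, w x ∈ 𝓜.G) {E : Site P i → 𝔸} (hEgc : ∀ x, E x ∈ 𝓜.gc) (hE0 : ∀ x, ‖E x‖ ≤ δ₀)
    (hE1 : ∀ x μ, ‖nabla c.ξ U μ E x‖ ≤ δ₁) :
    CondII 𝓜 F.X c α₁' (gaugeU w U)
      (adJ w fun b => newPot c.ξ (E b.src) (newPot c.ξ (A' b) ((U b : 𝔸) * (-E b.tgt) * ↑(U b)⁻¹))) := by
  -- standing facts
  have hUG : ∀ b, U b ∈ 𝓜.G := fun b => hI.gValued b (hXb b)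
  have hA : ∀ b, ‖A' b‖ ≤ α₁ := fun b => (hII.norm_lt b (hXb b)).le
  have hplaq : ∀ p, ‖(↑(plaq U p) : 𝔸) - 1‖ ≤ α₀ * c.ξ ^ 2 := fun p => (hI.plaq_lt p (hXp p)).le
  have hTn : ∀ (b : PBond P i) (y : Site P i), ‖(U b : 𝔸) * (-E y) * ↑(U b)⁻¹‖ ≤ δ₀ := fun b y => by
    rw [norm_conj_eq hG1 (hUG b), norm_neg]; exact hE0 y
  have hbud := budgetII_sharp hξ.le hα₀ hα₁ hδ₀ hδ₁ hs
  have hξα : c.ξ * α₁ ≤ 1 / 16 := by nlinarith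
  have hξδ : c.ξ * δ₀ ≤ 1 / 32 := by nlinarith
  -- abbreviations: `T b = −R(U(b))E(b₊)`, `N b = newPot ξ A′(b) (T b)`, `A″ b = newPot ξ E(b₋) (N b)`
  set T : PBond P i → 𝔸 := fun b => (U b : 𝔸) * (-E b.tgt) * ↑(U b)⁻¹ with hTdef
  set N : PBond P i → 𝔸 := fun b => newPot c.ξ (A' b) (T b) with hNdef
  have h2b : ∀ b, c.ξ * (‖A' b‖ + ‖T b‖) ≤ 1 / 16 ∧ ‖N b‖ ≤ ‖A' b‖ + δ₀ + 2 * c.ξ * α₁ * δ₀ ∧ ‖N b‖ ≤ α₁ + (9 / 8) * δ₀ :=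
    fun b => norm_newPot2_le_sharp hG1 hξ hα₁ hδ₀ hs (hUG b) (hE0 b.tgt) (hA b)
  have h3b : ∀ b, c.ξ * (‖E b.src‖ + ‖N b‖) ≤ 1 / 8 ∧
      ‖newPot c.ξ (E b.src) (N b)‖ ≤ ‖A' b‖ + 2 * δ₀ + 4 * c.ξ * (α₁ + 2 * δ₀) * δ₀ ∧
        ‖newPot c.ξ (E b.src) (N b)‖ ≤ ‖A' b‖ + (9 / 4) * δ₀ :=
    fun b => norm_newPot3_le_sharp hG1 hξ hα₁ hδ₀ hs (hUG b) (hE0 b.src) (hE0 b.tgt) (hA b)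
  refine ⟨fun b _ => ?_, fun b _ => ?_, fun q hq => ?_⟩
  · -- «A‴ has values in the algebra 𝔤ᶜ»
    show (w b.src : 𝔸) * newPot c.ξ (E b.src) (N b) * ↑(w b.src)⁻¹ ∈ 𝓜.gc
    refine hgc _ (hw _) _ (hgcN _ _ (hEgc _) _ (hgcN _ _ (hII.gcValued b (hXb b)) _ ?_ ((h2b b).1.trans (by norm_num)))
      ((h3b b).1.trans (by norm_num)))
    exact hgc _ (hUG b) _ (𝓜.gc.neg_mem (hEgc _))
  · -- `|A‴| < α₁′`
    show ‖(w b.src : 𝔸) * newPot c.ξ (E b.src) (N b) * ↑(w b.src)⁻¹‖ < α₁'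
    rw [norm_conj_eq hG1 (hw _)]
    have hlt : ‖A' b‖ < α₁ := hII.norm_lt b (hXb b)
    have hpos : 0 ≤ δ₁ + c.ξ * α₀ * δ₀ := by positivity
    calc ‖newPot c.ξ (E b.src) (N b)‖ ≤ ‖A' b‖ + (9 / 4) * δ₀ := (h3b b).2.2
      _ < α₁ + (9 / 4) * δ₀ := by linarith
      _ ≤ α₁ + 3 * (δ₀ + δ₁ + c.ξ * α₀ * δ₀) := by linarith
      _ ≤ α₁' := hα₁'
  · -- `|∇^ξ_{U^w}A‴| < α₁′`
    obtain ⟨x, μ, ν⟩ := q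
    dsimp only
    rw [nabla_gaugeU_adJ, norm_conj_eq hG1 (hw _)]
    have hcomm : (x.shift μ).shift ν = (x.shift ν).shift μ := shift_shift_comm x μ ν
    -- (a) the transported field: `‖∇_μ T_ν(x)‖ ≤ 2ξα₀δ₀ + δ₁`
    have hW : ‖(((U ⟨x, ν⟩)⁻¹ * U ⟨x, μ⟩ * U ⟨x.shift μ, ν⟩ * (U ⟨x.shift ν, μ⟩)⁻¹ : 𝔸ˣ) : 𝔸) - 1‖ ≤ α₀ * c.ξ ^ 2 := by
      rcases lt_trichotomy μ ν with hμν | rfl | hνμ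
      · rw [norm_loop_sub_one_eq hG1 (hUG ⟨x, ν⟩), ← plaq_eq U ⟨x, μ, ν, hμν⟩]
        exact hplaq _
      · rw [loop_eq_one_of_eq, Units.val_one, sub_self, norm_zero]; positivity
      · refine (norm_loop_sub_one_le_of_gt hG1 (hUG _) (hUG _) (hUG _) (hUG _)).trans ?_
        rw [← plaq_eq U ⟨x, ν, μ, hνμ⟩]
        exact hplaq _
    have hT : ‖(c.ξ : ℂ)⁻¹ • ((U ⟨x, μ⟩ : 𝔸) * T ⟨x.shift μ, ν⟩ * ↑(U ⟨x, μ⟩)⁻¹ - T ⟨x, ν⟩)‖ ≤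
        2 * c.ξ * α₀ * δ₀ + δ₁ := by
      have h := norm_covD_transport_le hG1 hξ (hUG ⟨x, μ⟩) (hUG ⟨x, ν⟩) (hUG ⟨x.shift μ, ν⟩) (hUG ⟨x.shift ν, μ⟩)
        (E (x.shift ν)) (E ((x.shift μ).shift ν))
      have hn : (c.ξ : ℂ)⁻¹ • ((U ⟨x.shift ν, μ⟩ : 𝔸) * E ((x.shift μ).shift ν) * ↑(U ⟨x.shift ν, μ⟩)⁻¹ - E (x.shift ν)) =
          nabla c.ξ U μ E (x.shift ν) := by rw [hcomm]; rfl
      rw [hn] at h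
      refine h.trans ?_
      have h1 : 2 * c.ξ⁻¹ * ‖(((U ⟨x, ν⟩)⁻¹ * U ⟨x, μ⟩ * U ⟨x.shift μ, ν⟩ * (U ⟨x.shift ν, μ⟩)⁻¹ : 𝔸ˣ) : 𝔸) - 1‖ *
          ‖E ((x.shift μ).shift ν)‖ ≤ 2 * c.ξ⁻¹ * (α₀ * c.ξ ^ 2) * δ₀ := by
        gcongr
        exact hE0 _
      have h2 : 2 * c.ξ⁻¹ * (α₀ * c.ξ ^ 2) * δ₀ = 2 * c.ξ * α₀ * δ₀ := by
        field_simp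
      linarith [hE1 (x.shift ν) μ]
    -- (b) the inner composition: `‖∇_μ N_ν(x)‖ ≤ (1+4ξδ₀)|∇_μ A′_ν(x)| + (1+4ξα₁)(2ξα₀δ₀ + δ₁)`
    have hN : ‖(c.ξ : ℂ)⁻¹ • ((U ⟨x, μ⟩ : 𝔸) * N ⟨x.shift μ, ν⟩ * ↑(U ⟨x, μ⟩)⁻¹ - N ⟨x, ν⟩)‖ ≤
        (1 + 4 * (c.ξ * δ₀)) * ‖nabla c.ξ U μ (fun y => A' ⟨y, ν⟩) x‖ +
          (1 + 4 * (c.ξ * α₁)) * (2 * c.ξ * α₀ * δ₀ + δ₁) := by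
      have hw' := norm_expI_prod_sub_one_lt_one hξ.le (((h2b ⟨x.shift μ, ν⟩).1).trans (by norm_num))
      have hA1 : c.ξ * ‖A' ⟨x, ν⟩‖ ≤ c.ξ * α₁ := mul_le_mul_of_nonneg_left (hA ⟨x, ν⟩) hξ.le
      have hA2 : c.ξ * ‖(U ⟨x, μ⟩ : 𝔸) * A' ⟨x.shift μ, ν⟩ * ↑(U ⟨x, μ⟩)⁻¹‖ ≤ c.ξ * α₁ := by
        rw [norm_conj_eq hG1 (hUG _)]; exact mul_le_mul_of_nonneg_left (hA ⟨x.shift μ, ν⟩) hξ.le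
      have hT1 : c.ξ * ‖T ⟨x, ν⟩‖ ≤ c.ξ * δ₀ := mul_le_mul_of_nonneg_left (hTn ⟨x, ν⟩ (x.shift ν)) hξ.le
      have hT2 : c.ξ * ‖(U ⟨x, μ⟩ : 𝔸) * T ⟨x.shift μ, ν⟩ * ↑(U ⟨x, μ⟩)⁻¹‖ ≤ c.ξ * δ₀ := by
        rw [norm_conj_eq hG1 (hUG _)]; exact mul_le_mul_of_nonneg_left (hTn ⟨x.shift μ, ν⟩ ((x.shift μ).shift ν)) hξ.le
      have hr : c.ξ * α₁ + c.ξ * δ₀ ≤ 1 / 8 := by nlinarith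
      have h := norm_covD_newPot_le_sharp (A := A' ⟨x, ν⟩) (A₁ := A' ⟨x.shift μ, ν⟩) (A' := T ⟨x, ν⟩)
        (A'₁ := T ⟨x.shift μ, ν⟩) (U ⟨x, μ⟩) hξ hw' hA1 hA2 hT1 hT2 hr
      refine h.trans (add_le_add le_rfl ?_)
      exact mul_le_mul_of_nonneg_left hT (by positivity)
    -- (c) the outer composition: `‖∇_μ A″_ν(x)‖ ≤ (1+4ξ(α₁+(9/8)δ₀))|∇_μ E(x)| + (1+4ξδ₀)‖∇_μ N_ν(x)‖`
    have hm : ∀ b, c.ξ * ‖N b‖ ≤ c.ξ * (α₁ + (9 / 8) * δ₀) := fun b =>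
      mul_le_mul_of_nonneg_left (h2b b).2.2 hξ.le
    have hA'' : ‖(c.ξ : ℂ)⁻¹ • ((U ⟨x, μ⟩ : 𝔸) * newPot c.ξ (E (x.shift μ)) (N ⟨x.shift μ, ν⟩) * ↑(U ⟨x, μ⟩)⁻¹ -
          newPot c.ξ (E x) (N ⟨x, ν⟩))‖ ≤
        (1 + 4 * (c.ξ * (α₁ + (9 / 8) * δ₀))) * ‖nabla c.ξ U μ E x‖ +
          (1 + 4 * (c.ξ * δ₀)) * ‖(c.ξ : ℂ)⁻¹ • ((U ⟨x, μ⟩ : 𝔸) * N ⟨x.shift μ, ν⟩ * ↑(U ⟨x, μ⟩)⁻¹ - N ⟨x, ν⟩)‖ := by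
      have hw' := norm_expI_prod_sub_one_lt_one hξ.le (((h3b ⟨x.shift μ, ν⟩).1).trans (by norm_num))
      have hE2 : c.ξ * ‖(U ⟨x, μ⟩ : 𝔸) * E (x.shift μ) * ↑(U ⟨x, μ⟩)⁻¹‖ ≤ c.ξ * δ₀ := by
        rw [norm_conj_eq hG1 (hUG _)]; exact mul_le_mul_of_nonneg_left (hE0 _) hξ.le
      have hN2 : c.ξ * ‖(U ⟨x, μ⟩ : 𝔸) * N ⟨x.shift μ, ν⟩ * ↑(U ⟨x, μ⟩)⁻¹‖ ≤ c.ξ * (α₁ + (9 / 8) * δ₀) := by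
        rw [norm_conj_eq hG1 (hUG _)]; exact hm ⟨x.shift μ, ν⟩
      have hr : c.ξ * δ₀ + c.ξ * (α₁ + (9 / 8) * δ₀) ≤ 1 / 8 := by nlinarith
      exact norm_covD_newPot_le_sharp (A := E x) (A₁ := E (x.shift μ)) (A' := N ⟨x, ν⟩) (A'₁ := N ⟨x.shift μ, ν⟩)
        (U ⟨x, μ⟩) hξ hw' (mul_le_mul_of_nonneg_left (hE0 x) hξ.le) hE2 (hm ⟨x, ν⟩) hN2 hr
    -- (d) assembly of the bound: strict in `|∇_μ A′_ν(x)| < α₁`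
    have hlt : ‖nabla c.ξ U μ (fun y => A' ⟨y, ν⟩) x‖ < α₁ := hII.nabla_lt (x, μ, ν) hq
    have hC₀ : 0 < 1 + 4 * (c.ξ * δ₀) := by positivity
    have hCN : 0 ≤ 1 + 4 * (c.ξ * (α₁ + (9 / 8) * δ₀)) := by positivity
    calc ‖nabla c.ξ U μ (fun y => newPot c.ξ (E (⟨y, ν⟩ : PBond P i).src) (N ⟨y, ν⟩)) x‖
        = ‖(c.ξ : ℂ)⁻¹ • ((U ⟨x, μ⟩ : 𝔸) * newPot c.ξ (E (x.shift μ)) (N ⟨x.shift μ, ν⟩) * ↑(U ⟨x, μ⟩)⁻¹ -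
            newPot c.ξ (E x) (N ⟨x, ν⟩))‖ := rfl
      _ ≤ (1 + 4 * (c.ξ * (α₁ + (9 / 8) * δ₀))) * δ₁ +
            (1 + 4 * (c.ξ * δ₀)) * ((1 + 4 * (c.ξ * δ₀)) * ‖nabla c.ξ U μ (fun y => A' ⟨y, ν⟩) x‖ +
              (1 + 4 * (c.ξ * α₁)) * (2 * c.ξ * α₀ * δ₀ + δ₁)) :=
          hA''.trans (add_le_add (mul_le_mul_of_nonneg_left (hE1 x μ) hCN) (mul_le_mul_of_nonneg_left hN hC₀.le))
      _ < (1 + 4 * (c.ξ * (α₁ + (9 / 8) * δ₀))) * δ₁ +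
            (1 + 4 * (c.ξ * δ₀)) * ((1 + 4 * (c.ξ * δ₀)) * α₁ + (1 + 4 * (c.ξ * α₁)) * (2 * c.ξ * α₀ * δ₀ + δ₁)) := by
          gcongr
      _ ≤ α₁ + 3 * (δ₀ + δ₁ + c.ξ * α₀ * δ₀) := hbud
      _ ≤ α₁' := hα₁'

/-! ## §3. Assembly: (i)–(iii) with constants continuous at the `G`-valued transformations -/

/-- **The «proper spaces» clause of (3.29) for (i)–(iii), sharp constants.**  Frame region = the whole lattice.  Let `(𝐔, 𝐉)` satisfy
(i)–(iii) with `(α₀, α₁, γ₀)` (`α₀, α₁ ≥ 0`), `v = w·e`, `w` `G`-valued, `e(x) = exp iξE(x) ∈ Gᶜ`, `E(x) ∈ 𝔤ᶜ`, `|E(x)| ≤ δ₀`,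
`|∇^ξ_{𝐔,μ}E(x)| ≤ δ₁` (covariant derivative in `𝐔` itself), `ξ(α₁ + 2δ₀) ≤ 1/16`.  Then `(𝐔, 𝐉)^v = (𝐔^v, R(v)𝐉)` satisfies (i)–(iii) with
any `α₀′ ≥ e^{2ξδ₀}α₀`, `γ₀′ ≥ e^{2ξδ₀}γ₀`, `α₁′ ≥ α₁ + (3 + 12α₁ + 3ξα₀)δ₀ + 4δ₁` — all three excesses VANISH as `(δ₀, δ₁) → 0`.  (i) for
`U^w` by `condI_gaugeU` and monotonicity, (ii) by `condII_near_sharp` after `∇^ξ_𝐔E ↦ ∇^ξ_UE` (`norm_nabla_factor_le`: `δ₁ᵁ ≤ (1+4ξα₁)δ₁ +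
4α₁δ₀`), (iii) by `condIII_near`, the factorisation by `factors_near`.  Compare `B12Spaces329Near.satisfiesI_III_act_near`.
[cite: Balaban1987RG1, (3.29) p.276] -/
theorem satisfiesI_III_act_near_sharp (hG1 : ∀ g ∈ 𝓜.G, ‖(g : 𝔸)‖ ≤ 1) (hGc : 𝓜.G ≤ 𝓜.Gc)
    (hgc : ∀ g ∈ 𝓜.G, ∀ X ∈ 𝓜.gc, (g : 𝔸) * X * ↑g⁻¹ ∈ 𝓜.gc)
    (hgcN : ∀ (ξ : ℝ) (X : 𝔸), X ∈ 𝓜.gc → ∀ Y ∈ 𝓜.gc, ξ * (‖X‖ + ‖Y‖) ≤ 1 / 4 → newPot ξ X Y ∈ 𝓜.gc)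
    {F : Frame P i 𝔸} (hXb : ∀ b, b ∈ F.X.bonds) (hXp : ∀ p, p ∈ F.X.plaqs) {c : StepConsts} (hξ : 0 < c.ξ) (hcB : 0 ≤ c.cB)
    {α₀ α₁ γ₀ δ₀ δ₁ α₀' α₁' γ₀' : ℝ} (hα₀ : 0 ≤ α₀) (hα₁ : 0 ≤ α₁) (hδ₁ : 0 ≤ δ₁) (hs : c.ξ * (α₁ + 2 * δ₀) ≤ 1 / 16)
    (hα₀' : Real.exp (2 * (c.ξ * δ₀)) * α₀ ≤ α₀') (hγ₀' : Real.exp (2 * (c.ξ * δ₀)) * γ₀ ≤ γ₀')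
    (hα₁' : α₁ + (3 + 12 * α₁ + 3 * c.ξ * α₀) * δ₀ + 4 * δ₁ ≤ α₁')
    {Φ : FieldPair P i 𝔸ˣ 𝔸} (h : SatisfiesI_III 𝓜 F c α₀ α₁ γ₀ Φ)
    {w : Site P i → 𝔸ˣ} (hw : ∀ x, w x ∈ 𝓜.G) {E : Site P i → 𝔸} (hEgc : ∀ x, E x ∈ 𝓜.gc)
    (heGc : ∀ x, expI c.ξ (E x) ∈ 𝓜.Gc) (hgcE : ∀ x, ∀ X ∈ 𝓜.gc, (expI c.ξ (E x) : 𝔸) * X * ↑(expI c.ξ (E x))⁻¹ ∈ 𝓜.gc)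
    (hE0 : ∀ x, ‖E x‖ ≤ δ₀) (hE1 : ∀ x μ, ‖nabla c.ξ Φ.U μ E x‖ ≤ δ₁) :
    SatisfiesI_III 𝓜 F c α₀' α₁' γ₀' (act (w * fun x => expI c.ξ (E x)) Φ) := by
  obtain ⟨hUGc, hJgc, U, A', hf, h1, h2, h3⟩ := h
  have hδ₀ : 0 ≤ δ₀ := (norm_nonneg _).trans (hE0 default)
  have hUG : ∀ b, U b ∈ 𝓜.G := fun b => h1.gValued b (hXb b)
  have hA : ∀ b, ‖A' b‖ ≤ α₁ := fun b => (h2.norm_lt b (hXb b)).le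
  -- the covariant derivative of `E` in the `G`-valued factor
  set δ₁' := (1 + 4 * c.ξ * α₁) * δ₁ + 4 * α₁ * δ₀ with hδ₁'
  have hδ₁'0 : 0 ≤ δ₁' := by positivity
  have hξα : c.ξ * α₁ ≤ 1 / 8 := by
    have : c.ξ * α₁ ≤ c.ξ * (α₁ + 2 * δ₀) := mul_le_mul_of_nonneg_left (by linarith) hξ.le
    linarith
  have hC : 0 ≤ 1 + 4 * c.ξ * α₁ := by positivity
  have hE1' : ∀ x μ, ‖nabla c.ξ U μ E x‖ ≤ δ₁' := fun x μ => by
    have h := norm_nabla_factor_le (E₁ := E (x.shift μ)) hξ hξα (hf ⟨x, μ⟩) (hA ⟨x, μ⟩) (hE0 x)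
    have h' : ‖(c.ξ : ℂ)⁻¹ • ((Φ.U ⟨x, μ⟩ : 𝔸) * E (x.shift μ) * ↑(Φ.U ⟨x, μ⟩)⁻¹ - E x)‖ ≤ δ₁ := hE1 x μ
    exact h.trans (by rw [hδ₁']; nlinarith [mul_le_mul_of_nonneg_left h' hC])
  have hα₀le : α₀ ≤ α₀' := by
    have : (1 : ℝ) * α₀ ≤ Real.exp (2 * (c.ξ * δ₀)) * α₀ :=
      mul_le_mul_of_nonneg_right (Real.one_le_exp (by positivity)) hα₀
    linarith
  -- the sharp (ii)-budget with `δ₁ᵁ = δ₁'` is implied by the displayed hypothesis on `α₁′`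
  have hα₁'' : α₁ + 3 * (δ₀ + δ₁' + c.ξ * α₀ * δ₀) ≤ α₁' := by
    have hξα16 : c.ξ * α₁ ≤ 1 / 16 := by nlinarith [mul_nonneg hξ.le hδ₀]
    have h4 : 3 * ((1 + 4 * c.ξ * α₁) * δ₁) ≤ 4 * δ₁ := by nlinarith [mul_le_mul_of_nonneg_right hξα16 hδ₁]
    have h5 : 3 * (4 * α₁ * δ₀) = 12 * α₁ * δ₀ := by ring
    rw [hδ₁']
    nlinarith
  refine ⟨?_, ?_, gaugeU w U,
    adJ w fun b => newPot c.ξ (E b.src) (newPot c.ξ (A' b) ((U b : 𝔸) * (-E b.tgt) * ↑(U b)⁻¹)), ?_, ?_, ?_, ?_⟩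
  · -- `𝐔^v` is `Gᶜ`-valued
    intro b _
    have hv : ∀ x, (w * fun x => expI c.ξ (E x)) x ∈ 𝓜.Gc := fun x => 𝓜.Gc.mul_mem (hGc (hw x)) (heGc x)
    exact 𝓜.Gc.mul_mem (𝓜.Gc.mul_mem (hv _) (hUGc b (hXb b))) (𝓜.Gc.inv_mem (hv _))
  · -- `R(v)𝐉` is `𝔤ᶜ`-valued
    intro b _
    have e : (act (w * fun x => expI c.ξ (E x)) Φ).J = adJ w (adJ (fun x => expI c.ξ (E x)) Φ.J) := adJ_mul _ _ _
    rw [e]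
    exact hgc _ (hw _) _ (hgcE _ _ (hJgc b (hXb b)))
  · exact factors_near hG1 hξ hα₁ hδ₀ hs hf hUG hA w hE0
  · exact condI_mono hcB hα₀le (condI_gaugeU hG1 hw h1)
  · exact condII_near_sharp hG1 hgc hgcN hXb hXp hξ hα₀ hα₁ hδ₀ hδ₁'0 hs hα₁'' h1 h2 hw hEgc hE0 hE1'
  · exact condIII_near hG1 hξ.le hα₀ hα₀' hγ₀' hw hE0 h3

/-- **«A sufficiently small neighborhood of G-valued transformations», qualitatively.**  For every pair satisfying (i)–(iii) with
`(α₀, α₁, γ₀)` and EVERY choice of larger constants `α₀′ > α₀`, `α₁′ > α₁`, `γ₀′ > γ₀` there is `δ > 0` (depending on `ξ, α₀, α₁, γ₀` and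
the target constants only) such that every `v = w·exp(iξE)` with `w` `G`-valued, `|E| ≤ δ`, `|∇^ξ_𝐔E| ≤ δ` carries the pair into the
conditions (i)–(iii) with `(α₀′, α₁′, γ₀′)` — e.g. the printed target `U^c_{k+1}(□₀, (1+2β)α₀, (1+2β)α₁, α₀·)` from `(1+β)α₀, (1+β)α₁`
for every `β > 0` (p. 275).  Requires `ξα₁ < 1/16` (room for the regime `ξ(α₁ + 2δ) ≤ 1/16`). [cite: Balaban1987RG1, (3.29) p.276] -/
theorem exists_neighbourhood (hG1 : ∀ g ∈ 𝓜.G, ‖(g : 𝔸)‖ ≤ 1) (hGc : 𝓜.G ≤ 𝓜.Gc)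
    (hgc : ∀ g ∈ 𝓜.G, ∀ X ∈ 𝓜.gc, (g : 𝔸) * X * ↑g⁻¹ ∈ 𝓜.gc)
    (hgcN : ∀ (ξ : ℝ) (X : 𝔸), X ∈ 𝓜.gc → ∀ Y ∈ 𝓜.gc, ξ * (‖X‖ + ‖Y‖) ≤ 1 / 4 → newPot ξ X Y ∈ 𝓜.gc)
    {F : Frame P i 𝔸} (hXb : ∀ b, b ∈ F.X.bonds) (hXp : ∀ p, p ∈ F.X.plaqs) {c : StepConsts} (hξ : 0 < c.ξ) (hcB : 0 ≤ c.cB)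
    {α₀ α₁ γ₀ α₀' α₁' γ₀' : ℝ} (hα₀ : 0 ≤ α₀) (hα₁ : 0 ≤ α₁) (hγ₀ : 0 ≤ γ₀) (hξα : c.ξ * α₁ < 1 / 16)
    (hα₀' : α₀ < α₀') (hα₁' : α₁ < α₁') (hγ₀' : γ₀ < γ₀') :
    ∃ δ : ℝ, 0 < δ ∧ ∀ {Φ : FieldPair P i 𝔸ˣ 𝔸}, SatisfiesI_III 𝓜 F c α₀ α₁ γ₀ Φ →
      ∀ {w : Site P i → 𝔸ˣ}, (∀ x, w x ∈ 𝓜.G) → ∀ {E : Site P i → 𝔸}, (∀ x, E x ∈ 𝓜.gc) →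
        (∀ x, expI c.ξ (E x) ∈ 𝓜.Gc) → (∀ x, ∀ X ∈ 𝓜.gc, (expI c.ξ (E x) : 𝔸) * X * ↑(expI c.ξ (E x))⁻¹ ∈ 𝓜.gc) →
          (∀ x, ‖E x‖ ≤ δ) → (∀ x μ, ‖nabla c.ξ Φ.U μ E x‖ ≤ δ) →
            SatisfiesI_III 𝓜 F c α₀' α₁' γ₀' (act (w * fun x => expI c.ξ (E x)) Φ) := by
  -- the three requirements on `δ`: regime, the `e^{2ξδ}` factors, the (ii)-excess `(7 + 12α₁ + 3ξα₀)δ`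
  set K := 7 + 12 * α₁ + 3 * c.ξ * α₀ with hK
  have hK0 : 0 < K := by positivity
  -- `e^{2ξδ} ≤ 1 + 4ξδ` for `2ξδ ≤ 1`; we ask `4ξδ·α₀ ≤ α₀′ − α₀`, `4ξδ·γ₀ ≤ γ₀′ − γ₀`
  obtain ⟨δ, hδ0, hδ1, hδ2, hδ3, hδ4⟩ : ∃ δ : ℝ, 0 < δ ∧ c.ξ * (α₁ + 2 * δ) ≤ 1 / 16 ∧
      4 * c.ξ * δ * α₀ ≤ α₀' - α₀ ∧ 4 * c.ξ * δ * γ₀ ≤ γ₀' - γ₀ ∧ K * δ ≤ α₁' - α₁ := by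
    -- a common `δ`: the minimum of the four positive thresholds
    set d₁ := (1 / 16 - c.ξ * α₁) / (2 * c.ξ) with hd₁
    set d₂ := (α₀' - α₀) / (4 * c.ξ * α₀ + 1) with hd₂
    set d₃ := (γ₀' - γ₀) / (4 * c.ξ * γ₀ + 1) with hd₃
    set d₄ := (α₁' - α₁) / K with hd₄
    have hd₁0 : 0 < d₁ := by rw [hd₁]; exact div_pos (by linarith) (by positivity)
    have hd₂0 : 0 < d₂ := by rw [hd₂]; exact div_pos (by linarith) (by positivity)
    have hd₃0 : 0 < d₃ := by rw [hd₃]; exact div_pos (by linarith) (by positivity)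
    have hd₄0 : 0 < d₄ := by rw [hd₄]; exact div_pos (by linarith) hK0
    refine ⟨min (min d₁ d₂) (min d₃ d₄), lt_min (lt_min hd₁0 hd₂0) (lt_min hd₃0 hd₄0), ?_, ?_, ?_, ?_⟩
    · have hle : min (min d₁ d₂) (min d₃ d₄) ≤ d₁ := (min_le_left _ _).trans (min_le_left _ _)
      have e : c.ξ * (α₁ + 2 * d₁) = 1 / 16 := by rw [hd₁]; field_simp; ring
      nlinarith [hξ.le]
    · have hle : min (min d₁ d₂) (min d₃ d₄) ≤ d₂ := (min_le_left _ _).trans (min_le_right _ _)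
      have e : d₂ * (4 * c.ξ * α₀ + 1) = α₀' - α₀ := by rw [hd₂]; field_simp
      have h0 : 0 ≤ min (min d₁ d₂) (min d₃ d₄) := (lt_min (lt_min hd₁0 hd₂0) (lt_min hd₃0 hd₄0)).le
      nlinarith [mul_le_mul_of_nonneg_right hle (by positivity : (0 : ℝ) ≤ 4 * c.ξ * α₀ + 1)]
    · have hle : min (min d₁ d₂) (min d₃ d₄) ≤ d₃ := (min_le_right _ _).trans (min_le_left _ _)
      have e : d₃ * (4 * c.ξ * γ₀ + 1) = γ₀' - γ₀ := by rw [hd₃]; field_simp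
      have h0 : 0 ≤ min (min d₁ d₂) (min d₃ d₄) := (lt_min (lt_min hd₁0 hd₂0) (lt_min hd₃0 hd₄0)).le
      nlinarith [mul_le_mul_of_nonneg_right hle (by positivity : (0 : ℝ) ≤ 4 * c.ξ * γ₀ + 1)]
    · have hle : min (min d₁ d₂) (min d₃ d₄) ≤ d₄ := (min_le_right _ _).trans (min_le_right _ _)
      have e : K * d₄ = α₁' - α₁ := by rw [hd₄]; field_simp
      nlinarith [mul_le_mul_of_nonneg_left hle hK0.le]
  refine ⟨δ, hδ0, fun h w hw E hEgc heGc hgcE hE0 hE1 => ?_⟩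
  -- `e^{2ξδ} ≤ 1 + 4ξδ` (`2ξδ ≤ 1/16 ≤ 1`)
  have h2ξδ : 2 * (c.ξ * δ) ≤ 1 := by nlinarith
  have hexp : Real.exp (2 * (c.ξ * δ)) ≤ 1 + 4 * c.ξ * δ := by
    have h := Real.abs_exp_sub_one_sub_id_le (x := 2 * (c.ξ * δ)) (by rw [abs_of_nonneg (by positivity)]; exact h2ξδ)
    have h' := (abs_le.mp h).2
    have hx0 : 0 ≤ 2 * (c.ξ * δ) := by positivity
    have hx2 : (2 * (c.ξ * δ)) ^ 2 ≤ 2 * (c.ξ * δ) := by rw [sq]; exact mul_le_of_le_one_right hx0 h2ξδ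
    linarith
  refine satisfiesI_III_act_near_sharp hG1 hGc hgc hgcN hXb hXp hξ hcB hα₀ hα₁ hδ0.le hδ1 ?_ ?_ ?_ h hw hEgc heGc hgcE
    hE0 hE1
  · nlinarith [mul_le_mul_of_nonneg_right hexp hα₀]
  · nlinarith [mul_le_mul_of_nonneg_right hexp hγ₀]
  · rw [hK] at hδ4; nlinarith

end

end Literature.MathematicalPhysics.QuantumFieldTheory.Balaban1983to89.B12Spaces329NearSharp
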